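import Literature.Claims.NS.ClayR3LocalEnergyBridge
import Literature.Analysis.FluidPDE.ClayDataSobolev
import Literature.Analysis.FluidPDE.AxisymmetricNoSwirlGlobalHolds
import HarnessLib

/-!
# Claim skeleton (D-0090 NS-CLAIMS, C170): Vukolov, «Global Regularity for the Navier–Stokes Equations:
# A Geometric Resolution via the Evolutionary Layer-by-Layer Gauge Method» (Zenodo 18702245, v3, 2026-02-19, 92 pp.)

Typed skeleton of Valeri Vukolov, *Global Regularity for the Navier–Stokes Equations: A Geometric
Resolution via the Evolutionary Layer-by-Layer Gauge Method*, Zenodo record **18702245** (concept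
18664361, v3 of 3, created 2026-02-19; PDF sha16 `bd3eadae84e0ecf0`, 92 pp.; PDF page = printed page =
file `pages/pNNN.txt` of the census pin `run/shared/lean/pub/ns-claims/census/texts/Vukolov2026/`) = bib
`Vukolov2026` = TEXT OF RECORD of cell `ns-claims` row C170 (RULINGS v1.45, lead-1 g7
2026-08-27T15:58:53Z; reserve row, TAIL-TRANCHE §B l.77); «p.N l.M» = line M of `pages/pNNN.txt`; lit
seat's `sources/Vukolov2026/LOCATORS.md` v2 (ns-claims-lit-2 g6/g7). UNREFEREED CLAIM under adjudication
— NOTHING in this file asserts a step of the paper: the printed statements are `def … : Prop`; the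
`theorem`s are the kernel composition of the paper's OWN implications, two tree facts (constant data;
axisymmetric-no-swirl regularity) and the Clay (A) link. Typist `ns-claims-typist-1` g6; CARD
`claims/Vukolov2026/CARD.md` (PREDICTION sealed 2026-08-27T16:02:44Z, sha16 `be3068d5094f37a6`, written
from RULINGS v1.45 + LOCATORS §0/§2 + pp. 1, 8–9 only). Verdict vocabulary is the refuter's / referee's.

## The claimed statement, as printed (Theorem 1.5, p.9 l.6–12; = Theorem 10.1 p.35 l.13–22 with a force)
«Theorem 1.5 (Global regularity for all smooth initial data). Let V0 be any smooth divergence-free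
vector field on R³ (or on a bounded domain Ω ⊂ R³ with smooth boundary and the no-slip condition
V0|∂Ω = 0). Then the unique smooth solution of the three-dimensional Navier–Stokes equations with initial
data V0 exists for all time t ≥ 0 and remains smooth for all t.» Lead-in p.9 l.3–5: «Since A is both
dense and closed, it must coincide with the space of all smooth divergence-free fields. Combined with
the regularity of axisymmetric flows and the results of [27] establishing global regularity for
gaugeable data, this yields:». Abstract p.1 l.7–9 names «the regularity problem as formulated by the
Clay Mathematics Institute».

RENDERING (cell convention; `lean search` done, tree vocabulary REUSED BY NAME, nothing re-declared):
the ℝ³ UNFORCED face is typed (`ClaimedTheorem`): for every `ν > 0` and every `C^∞` divergence-free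
`V₀ : ℝ³ → ℝ³` (NO decay — the printed class, WIDER than Fefferman's (4)) there is a classical solution
`(V, P)` of the unforced system on `[0, ∞) × ℝ³` (`IsClassicalNSSolutionOn (Ici 0) ν 0 V P`, i.e. (1)(2)
and joint smoothness (6)) with `V 0 = V₀`. «unique» is printed as an attribute of «the» solution, not
argued: on the decay-free class classical uniqueness FAILS (parasitic `u = c(t)`, tree
`ClaySettingParasiticDrift`), so uniqueness is NOT typed into the claim (a kill of it would be a typing
artefact, F3); on Clay data the finite-energy smooth solution is unique (tree
`IsClassicalNSSolutionOn.eq_of_finiteEnergy`) and «the unique smooth solution exists for all time» has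
exactly the meaning of the CLAY READING `ClaimedTheoremA` (second face, `claimedTheoremA_iff_clayA`
PROVED). The bounded-domain / no-slip face and Theorem 10.1's forced face are RECORDED, not typed
(not Clay (A)–(D) objects). The viscosity is a fixed `ν > 0` throughout the text ((1) p.4; «ν∆» p.11).

## Clay delta (reference `Literature.Claims.NS.ClayVariants`; LOCATORS §2; keeper lit-4 g9 16:02:38Z)
Nearest: (A) `clayR3.Regularity`. Δ1 domain ℝ³ = (bounded Ω recorded) · Δ2 equations NS, ν > 0 = ·
Δ3 force ≡ 0 = (Thm 10.1's F recorded) · Δ4 data «any smooth divergence-free field», NO decay ⊋ (4) —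
the claim is STRONGER than (A) on the data axis (the entropy functional (9) p.11 needs `H(0) < ∞` with
the Gaussian weight `e^{−Φ}`, `Φ = |x|²/4`, Cor 2.5 p.12 / Cor 6.2 p.25 «Assume that H(0) < ∞» — a
hypothesis of the rank-2 chain, recorded there) · Δ5 solution class = (6); (7) bounded energy is NOT
printed and not implied on the decay-free class · Δ6 «unique» — see RENDERING · Δ7 one fixed ν > 0,
typed ∀ ν > 0 · Δ8 none. CLAY LINK: `ClaimedTheoremA ↔ clayR3.Regularity` PROVED (`Iff` by unfolding);
from the LITERAL face the one honest extra hypothesis is the EXISTENTIAL-per-datum energy clause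
`ClayDelta` (for every Clay datum SOME global classical solution has slab-bounded energy — TRUE iff (A),
never refutable by a parasite), `clayA_of_delta : ClayDelta → clayR3.Regularity` PROVED through the tree
door `clayR3_solvable_of_classical_slabBoundedEnergy`; `clay_of_claimed_of_delta` PROVED. No «wrong
problem» axis is typed as a head (keeper's letter decides Gs/U on the two faces).

## Step index (dependency order of the PRINTED proof: §10.2 Steps 1–5 p.35 l.23–40 ← Thm 9.6 p.34
## l.7–11 «For rank-2 fields, this follows from Theorem 6.7. For rank-1 fields, … Theorem 9.4. For
## rank-0 fields, it is trivial.» ← Cor 2.3 p.10 l.44–47 «This corollary justifies focusing on rank-2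
## fields …; the exceptional cases will be handled separately in Section 9»)
* Step 1 = `Step_C23` — **Corollary 2.3 (Generic fields are rank 2) p.10 l.44–46**, VERBATIM: «For a
  smooth divergence-free field V that is not of the form αe with e·∇e = 0, and not constant, we have
  rank(∇V) = 2 on an open dense subset of its domain.» (Printed right after Thm 2.1 p.10 l.31–40, whose
  hypothesis `det(∇V) ≡ 0` the corollary DROPS; it is the exhaustiveness of the three cases of Thm 9.6's
  proof.) Typist's flag: suspicious (a smooth divergence-free field may have `rank ∇V = 3` at a point,
  e.g. `V(x,y,z) = (y, z, x)`); refuter's call. Binder `hC23`.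
* Step 2 = `Step_67` — **Theorem 6.7 p.27 l.7–11** (= Thm 1.1 p.8 l.35–41 + Thm 6.5 p.26 l.36–38):
  «Let V0 be a smooth divergence-free field with rank(∇V0) = 2. Then V0 is evolutionary gaugeable, and
  the corresponding Navier–Stokes solution is globally regular.» Typed on Cor 2.3's rank-2 class
  (`IsRank2`: rank 2 on an open dense set — the class Thm 9.6's proof feeds it; the everywhere-rank-2
  reading of §1.3 p.8 l.7–8 is the face `Step_67'`). Its printed proof is the rank-2 chain §§3–6 (Thm
  3.5 p.17 layer elimination with the PRESCRIBED interpolation (19) p.15; §5.6 p.23 l.82–95 «verification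
  of the gauge system» where `Vax(t)` is DEFINED as the pull-back of the Navier–Stokes solution `V(t)`;
  Remark 5.4 p.23 «ψ0 = id … we set Vax(0) = V0»; Thm 6.1 p.25 l.1–12 / Thm G.6 (211) p.67 l.7–11
  entropy inequality with «a constant C depending only on ν, the C³ norms of Vax, and the choice of Φ …
  the constants Ck can be chosen independently of time on any finite interval where the solution
  exists»; Cor 6.2 (52); Lemmas 6.3/6.4; Thm 6.5 p.26 l.36–59 continuation «constants depending only on
  T and the initial data … remain bounded as T → T⁻max because they depend on Hk+4(0) and T») — typed
  below at CHAIN LEVEL over an abstract entropy readout (`EntropyReadout`, faces `Step_G6_interval` /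
  `Step_G6_uniform` / `Step_65_bounds` / `Step_65_continuation`, the C167 `Step_T133`/`_uniform`
  pattern asked by RULINGS v1.45 (h2)); those faces are RECORDED (not binders of `claim_of_steps`:
  Thm 9.6 consumes Thm 6.7 as a whole). Binder `h67`.
* Step 3 = `Step_94` — **Theorem 9.4 p.33 l.62–75**: «Every smooth rank-1 divergence-free field is
  evolutionary gaugeable» (proof: straighten `e` to `∂z` (Lemma 9.2), then `ϕ∗Ṽ0 = f(r)∂z` (Lemma 9.3),
  `V0 = (ψ⁻¹)∗Vax` (69) — a DATUM-LEVEL conjugation, no time evolution printed). Binder `h94`.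
* Step 4 = `Step_rank0` — **p.34 l.11** «For rank-0 fields, it is trivial» (Thm 1.2 p.8 l.46 «If
  rank(∇V0) = 0, then V0 is constant and trivially gaugeable»). TRUE for the literal class `InA`:
  PROVED (`step_rank0_holds`: the constant flow `V ≡ c`, `P ≡ 0`, identity gauge). Binder `h0`.
* DERIVED: `Step_96` — **Theorem 9.6 (All fields are gaugeable) p.34 l.7–11**: every smooth
  divergence-free field on ℝ³ is evolutionary gaugeable — `step96_of_cases hC23 h67 h94 h0` PROVED
  (the printed three-case proof). §10.2 Step 1 p.35 l.23–26 consumes exactly `Step_96`.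
* DERIVED: §10.2 Steps 2–5 p.35 l.27–40 — Def 2.6 unpacked: membership CONTAINS a global classical
  Navier–Stokes solution from `V₀` (`globalSol_of_inA`, two lines). Step 3's «Vax(t) is globally regular
  by [22, 12]» (axisymmetric flows without swirl) is the tree THEOREM
  `axisymmetric_no_swirl_global_regularity_holds` (`step_axisym_holds`) — TRUE, and NOT NEEDED by the
  kernel composition (smoothness of `V` is part of «V(t) satisfying the Navier–Stokes equations» as a
  classical solution in Def 2.6's rendering; recorded).
* COMPOSITION: **`claim_of_steps (hC23 : Step_C23) (h67 : Step_67) (h94 : Step_94) (h0 : Step_rank0) :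
  ClaimedTheorem` PROVED**; `claim_of_steps₃ hC23 h67 h94` (binder 4 discharged) PROVED.
* ROUTE-5b RECORDS (RULINGS v1.45 (h1), kernel facts about the TYPED definition, no verdict implied):
  Def 2.6 p.12 l.22–27 puts «a global smooth solution … with V(t) = (ψt)∗Vax(t) satisfying the
  Navier–Stokes equations» INSIDE the definition of `A`; with the reference field unconstrained (§2.4
  p.11 l.20 «For any reference field Vax(t)»; Remark 5.4 p.23 «we set Vax(0) = V0») membership is
  EQUIVALENT to the existence of a global classical solution: `inA_iff_globalSol`, hence
  **`step96_iff_claimedTheorem : Step_96 ↔ ClaimedTheorem`** PROVED. The axisymmetric-reference face of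
  the definition (§2.3 (4) p.11 l.2–8 «Let Vax(t) be a smooth axisymmetric flow without swirl»; Thm 1.1
  «for some axisymmetric reference field Vax»; §10.2 Step 3) is `InAax` / `Step_96ax`, with
  `step96_of_step96ax` PROVED; since `ψ0 = id` (§2.4 p.11 l.14) forces `V₀ = Vax(0)`, `InAax ν V₀`
  implies `V₀` is itself axisymmetric without swirl (`isAxisymmetric_of_inAax` PROVED) — refuter's call.
* SECOND PRINTED ROUTE (§1.4 p.9 l.3–4, abstract p.1 l.24–27: «dense» Thm 7.5 p.29 l.36–41 + «closed»
  Thm 8.7 p.31 l.110–125 ⇒ A = everything; Remark 9.7 p.34 l.12–15 says closure is «used later» for the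
  same conclusion): `Step_75` (sequential C^∞-density of `A`, the grain of Thm 7.5's proof «the sequence
  V0^(N) converges to V0 in C∞ … each V0^(N) ∈ A»; its load-bearing input Thm 7.2 p.28 l.6–8 «each
  truncated field belongs to A», with Step 2 p.28 l.32–37 «V̄0 is axisymmetric (hence gaugeable)» and
  the Nash–Moser openness Thm H.11, RECORDED in the docstring) and `Step_87` (sequential C^∞-closedness,
  Thm 8.7; its consumed display Lemma 8.1 p.30 l.27–28 «a constant C independent of n such that Cn ≤ C»
  over the conformal entropy (66) and the datum-level gauge relation (64) p.29–30 RECORDED);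
  `step96_of_dense_closed : Step_75 → Step_87 → Step_96` and `claim_of_dense_closed` PROVED.
Not typed (recorded): Thm 2.1 / App. L (classification under `det ∇V ≡ 0`), Thm 2.7, §§3–5 constructions
(Lemma 3.1 (16), (19), Thm 3.5, §4 stream-function gauge, Lemmas 5.1–5.6, (47) — the coupled system is
replaced everywhere by its printed equivalent «(ψt)∗Vax(t) satisfies the Navier–Stokes equations», (6)
p.11 l.20–25 and §5.6 item 3 p.23 l.88–92), Apps. A–K, the bounded-domain and forced faces, [26]–[28].

WHAT THIS IS NOT: not a claim about NS regularity or blow-up; not a claim about any author beyond the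
typed locator.
-/

open scoped ContDiff ENNReal NNReal Topology Laplacian InnerProductSpace RealInnerProductSpace
open Set Filter MeasureTheory Function

namespace Literature.Claims.NS.Vukolov2026

open Literature.Analysis Literature.Analysis.FluidPDE Literature.Claims.NS.ClayVariants

noncomputable section

/-! ## Vocabulary -/

/-- `ℝ³` (§2.1 p.10 l.8–10). [cite: Vukolov2026, §2.1 p.10 l.8–10] -/
abbrev E3 : Type := EuclideanSpace ℝ (Fin 3)

/-- **The data class of Theorem 1.5** (p.9 l.6–7): «any smooth divergence-free vector field on R³» —
`C^∞` and divergence-free, NO decay or integrability condition. [cite: Vukolov2026, Thm 1.5 p.9 l.6–7] -/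
def IsDatum (V₀ : E3 → E3) : Prop :=
  ContDiff ℝ ∞ V₀ ∧ NSWave0.IsDivFree V₀

/-- The rank of the Jacobian `∇V(x)` (§2.1 p.10 l.10–11 «(∇V)ij = ∂jVi»): the dimension of the range of
the Fréchet derivative `fderiv ℝ V x`. [cite: Vukolov2026, §2.1 p.10 l.10–11; Thm 2.1 p.10 l.31–40] -/
def jacRank (V : E3 → E3) (x : E3) : ℕ :=
  Module.finrank ℝ (LinearMap.range (fderiv ℝ V x).toLinearMap)

/-- **«rank-2 field» at the grain Corollary 2.3 p.10 l.44–46 prints it** («rank(∇V) = 2 on an open dense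
subset of its domain») — the class Thm 9.6's proof p.34 l.10 hands to Theorem 6.7.
[cite: Vukolov2026, Cor 2.3 p.10 l.44–46] -/
def IsRank2 (V : E3 → E3) : Prop :=
  ∃ S : Set E3, IsOpen S ∧ Dense S ∧ ∀ x ∈ S, jacRank V x = 2

/-- The everywhere reading of «rank(∇V0) = 2» (§1.3 p.8 l.7–8 «the kernel Ker(∇V0) is one-dimensional.
Its integral curves form a foliation of space by lines»; Thm 1.1 p.8 l.35). [cite: Vukolov2026, §1.3 p.8 l.7–8; Thm 1.1 p.8 l.35] -/
def IsRank2' (V : E3 → E3) : Prop :=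
  ∀ x, jacRank V x = 2

/-- **«rank-1 field»** (Thm 2.1 p.10 l.38–39; Thm 9.4 proof p.33 l.64 «Let V0 = αe be a rank-1 field»;
Cor 2.3 «of the form αe with e·∇e = 0»): `V = α e` with `e` a smooth unit field whose integral curves
are straight lines, `(e·∇)e = 0`, and `α` smooth. [cite: Vukolov2026, Thm 2.1 p.10 l.38–39; Cor 2.3 p.10 l.44–45] -/
def IsRank1Form (V : E3 → E3) : Prop :=
  ∃ (α : E3 → ℝ) (e : E3 → E3), ContDiff ℝ ∞ α ∧ ContDiff ℝ ∞ e ∧ (∀ x, ‖e x‖ = 1) ∧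
    (∀ x, fderiv ℝ e x (e x) = 0) ∧ ∀ x, V x = α x • e x

/-- **«rank-0 field»**: `V` is constant in space (Thm 2.1 p.10 l.40; Thm 1.2 p.8 l.46; Cor 2.3 «not
constant»). [cite: Vukolov2026, Thm 2.1 p.10 l.40; Thm 1.2 p.8 l.46] -/
def IsConst (V : E3 → E3) : Prop :=
  ∃ c : E3, ∀ x, V x = c

/-- **Push-forward of a vector field by a diffeomorphism** (§2.1 p.10 l.11–12 «ϕ∗V = (Dϕ)V ∘ ϕ⁻¹»; (6)
p.11 l.21 «(ψt)∗Vax(t) = (Dψt)Vax(t) ∘ ψt⁻¹»), written with an explicit inverse map `φi`.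
[cite: Vukolov2026, §2.1 p.10 l.11–12; (6) p.11 l.20–24] -/
def pushforward (φ φi : E3 → E3) (W : E3 → E3) : E3 → E3 :=
  fun y => fderiv ℝ φ (φi y) (W (φi y))

/-- **A smooth one-parameter family of diffeomorphisms `ψt`, `t ≥ 0`, with `ψ0 = id`** (§2.4 p.11 l.14
«Let ψt be a smooth one-parameter family of diffeomorphisms with ψ0 = id»): forward maps and inverse
maps, both jointly `C^∞` on `[0, ∞) × ℝ³`, mutually inverse for `t ≥ 0`. The gauge field
`Ut = ∂tψt ∘ ψt⁻¹` (5) and the metric `g(t) = ψt* g_euclid` (7) with its evolution (8) are FUNCTIONS of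
this family (recorded; not separate data). [cite: Vukolov2026, §2.4 (5)–(8) p.11 l.12–33] -/
structure GaugeFamily where
  /-- `ψt`. -/
  ψ : ℝ → E3 → E3
  /-- `ψt⁻¹`. -/
  ψi : ℝ → E3 → E3
  smooth : IsSmoothSpaceTimeOn (Ici 0) ψ
  smooth_inv : IsSmoothSpaceTimeOn (Ici 0) ψi
  left_inv : ∀ t, 0 ≤ t → ∀ x, ψi t (ψ t x) = x
  right_inv : ∀ t, 0 ≤ t → ∀ y, ψ t (ψi t y) = y
  /-- `ψ0 = id` (§2.4 p.11 l.14; Remark 5.4 p.23 l.76). -/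
  init : ∀ x, ψ 0 x = x

/-- The identity gauge `ψt = id` for all `t`. [cite: Vukolov2026, §2.4 p.11 l.14] -/
def GaugeFamily.trivial : GaugeFamily where
  ψ := fun _ x => x
  ψi := fun _ x => x
  smooth := contDiff_snd.contDiffOn
  smooth_inv := contDiff_snd.contDiffOn
  left_inv := fun _ _ _ => rfl
  right_inv := fun _ _ _ => rfl
  init := fun _ => rfl

/-- **Definition 2.6 (evolutionary gaugeable) p.12 l.22–25, VERBATIM grain**: «A smooth divergence-free
field V0 is called evolutionary gaugeable if there exists a global smooth solution (U(t), g(t), ψt) of the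
gauge system described above, with V(t) = (ψt)∗Vax(t) satisfying the Navier–Stokes equations, and such
that V(0) = V0. We denote by A the set of all such fields.» Rendering: a smooth global gauge family
`ψt` (`U`, `g` its functions (5), (7), (8)), a jointly smooth reference field `Vax(t)` («any reference
field», §2.4 p.11 l.20; Remark 5.4 p.23 «we set Vax(0) = V0») and a pressure, such that
`V(t) := (ψt)∗Vax(t)` is a CLASSICAL solution of the unforced Navier–Stokes system with viscosity `ν` on
`[0, ∞) × ℝ³` with `V(0) = V₀`; the field equation (47) p.23 for `Vax` is replaced by its printed
equivalent «V(t) = (ψt)∗Vax(t) satisfies the Navier–Stokes equations» ((6) p.11 l.20–25 «if and only if»;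
§5.6 item 3 p.23 l.88–92). [claim: Vukolov2026, status: under-review] [cite: Vukolov2026, Def 2.6 p.12 l.22–27; (6) p.11 l.20–25; §5.6 p.23 l.82–95] -/
def InA (ν : ℝ) (V₀ : E3 → E3) : Prop :=
  ∃ (G : GaugeFamily) (Vax : ℝ → E3 → E3) (P : ℝ → E3 → ℝ), IsSmoothSpaceTimeOn (Ici 0) Vax ∧
    IsClassicalNSSolutionOn (Ici 0) ν 0 (fun t => pushforward (G.ψ t) (G.ψi t) (Vax t)) P ∧
      pushforward (G.ψ 0) (G.ψi 0) (Vax 0) = V₀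

/-- **Definition 2.6 with the AXISYMMETRIC-NO-SWIRL reference field** (§2.3 (4) p.11 l.2–8 «Let Vax(t) be
a smooth axisymmetric flow without swirl, defined for all t ≥ 0 … V^θ ≡ 0»; Thm 1.1 p.8 l.40 «for some
axisymmetric reference field Vax»; §10.2 Step 3 p.35 l.30–31 «The axisymmetric reference field Vax(t)»):
`InA` with `Vax(t)` axisymmetric about the `z`-axis and swirl-free for every `t ≥ 0` (tree predicates
`IsAxisymmetric`, `HasNoSwirl`). [claim: Vukolov2026, status: under-review] [cite: Vukolov2026, §2.3 (4) p.11 l.2–8; Def 2.6 p.12 l.22–25; §10.2 Step 3 p.35 l.30–34] -/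
def InAax (ν : ℝ) (V₀ : E3 → E3) : Prop :=
  ∃ (G : GaugeFamily) (Vax : ℝ → E3 → E3) (P : ℝ → E3 → ℝ), IsSmoothSpaceTimeOn (Ici 0) Vax ∧
    (∀ t, 0 ≤ t → IsAxisymmetric (Vax t) ∧ HasNoSwirl (Vax t)) ∧
    IsClassicalNSSolutionOn (Ici 0) ν 0 (fun t => pushforward (G.ψ t) (G.ψi t) (Vax t)) P ∧
      pushforward (G.ψ 0) (G.ψi 0) (Vax 0) = V₀

/-- `C^∞` convergence of a sequence of fields on compact sets, all derivatives («the C∞ topology», Thm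
1.3 p.8 l.49–50, Thm 7.5 p.29 l.37; Lemma 7.1 «converges to V0 in C∞»), quantified without junk values.
[cite: Vukolov2026, Thm 1.3 p.8 l.48–50; Thm 7.5 p.29 l.36–41] -/
def CinfConverges (W : ℕ → E3 → E3) (V₀ : E3 → E3) : Prop :=
  ∀ k : ℕ, ∀ K : Set E3, IsCompact K → ∀ ε : ℝ, 0 < ε → ∃ N : ℕ, ∀ n, N ≤ n → ∀ x ∈ K,
    ‖iteratedFDeriv ℝ k (W n) x - iteratedFDeriv ℝ k V₀ x‖ < ε

/-! ## The claimed statement -/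

/-- **CLAIMED THEOREM = Theorem 1.5 p.9 l.6–12, ℝ³ unforced face, LITERAL data class**: for every
`ν > 0` and every smooth divergence-free `V₀` on ℝ³ there is a global classical solution `(V, P)` of the
Navier–Stokes equations on `[0, ∞) × ℝ³` with `V(0) = V₀` («exists for all time t ≥ 0 and remains smooth
for all t»; «unique» recorded, see the module docstring). [claim: Vukolov2026, status: under-review]
[cite: Vukolov2026, Thm 1.5 p.9 l.6–12; Thm 10.1 p.35 l.13–22] -/
def ClaimedTheorem : Prop :=
  ∀ ν : ℝ, 0 < ν → ∀ V₀ : E3 → E3, IsDatum V₀ →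
    ∃ (V : ℝ → E3 → E3) (P : ℝ → E3 → ℝ), IsClassicalNSSolutionOn (Ici 0) ν 0 V P ∧ V 0 = V₀

/-- **CLAIMED THEOREM, CLAY READING** (abstract p.1 l.7–9 «resolving the regularity problem as formulated
by the Clay Mathematics Institute»; §10.3.3 p.37): on Fefferman's data class (4) the words «the unique
smooth solution … exists for all time» mean Clay-sense solvability ((6)(7); the finite-energy classical
solution is unique there, tree `IsClassicalNSSolutionOn.eq_of_finiteEnergy`). Token-for-token (A):
`claimedTheoremA_iff_clayA`. [claim: Vukolov2026, status: under-review] [cite: Vukolov2026, Thm 1.5 p.9 l.6–12; abstract p.1 l.7–9] [cite: FeffermanClay2006, (A) p. 2] -/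
def ClaimedTheoremA : Prop :=
  ∀ ν : ℝ, 0 < ν → ∀ V₀ : E3 → E3, ContDiff ℝ ∞ V₀ → NSWave0.IsDivFree V₀ → HasRapidSpatialDecay V₀ →
    clayR3.Solvable ν 0 V₀

/-! ## The Steps of the printed argument (dependency order of §10.2 ← Thm 9.6 ← Cor 2.3) -/

/-- **Step 1 — Corollary 2.3 (Generic fields are rank 2) p.10 l.44–46**, VERBATIM: «For a smooth
divergence-free field V that is not of the form αe with e·∇e = 0, and not constant, we have rank(∇V) =
2 on an open dense subset of its domain.» (The exhaustiveness of Thm 9.6's three cases p.34 l.10–11;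
l.47 «This corollary justifies focusing on rank-2 fields in the main gauge construction; the
exceptional cases will be handled separately in Section 9».) Typist's flag: suspicious — Thm 2.1's
hypothesis `det(∇V) ≡ 0` is dropped. [claim: Vukolov2026, status: under-review] [cite: Vukolov2026, Cor 2.3 p.10 l.44–47; Thm 9.6 proof p.34 l.10–11] -/
def Step_C23 : Prop :=
  ∀ V : E3 → E3, IsDatum V → ¬ IsRank1Form V → ¬ IsConst V → IsRank2 V

/-- **Step 2 — Theorem 6.7 (Evolutionary gaugeability of rank-2 fields) p.27 l.7–11** (= Thm 1.1 p.8 +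
Thm 6.5 p.26): «Let V0 be a smooth divergence-free field with rank(∇V0) = 2. Then V0 is evolutionary
gaugeable, and the corresponding Navier–Stokes solution is globally regular», on Cor 2.3's rank-2 class.
Printed proof = the rank-2 chain §§3–6 (faces `Step_G6_interval`, `Step_G6_uniform`,
`Step_65_bounds`, `Step_65_continuation` below). [claim: Vukolov2026, status: under-review] [cite: Vukolov2026, Thm 6.7 p.27 l.7–11; Thm 1.1 p.8 l.35–41; Thm 6.5 p.26 l.36–59] -/
def Step_67 : Prop :=
  ∀ ν : ℝ, 0 < ν → ∀ V₀ : E3 → E3, IsDatum V₀ → IsRank2 V₀ → InA ν V₀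

/-- **Step 2, everywhere-rank-2 face** (Thm 1.1 / §1.3 p.8 l.7–8 reading of «rank(∇V0) = 2»).
[claim: Vukolov2026, status: under-review] [cite: Vukolov2026, Thm 6.7 p.27 l.7–11; §1.3 p.8 l.7–8] -/
def Step_67' : Prop :=
  ∀ ν : ℝ, 0 < ν → ∀ V₀ : E3 → E3, IsDatum V₀ → IsRank2' V₀ → InA ν V₀

/-- **Step 3 — Theorem 9.4 (Rank-1 fields are gaugeable) p.33 l.62–75**: «Every smooth rank-1
divergence-free field is evolutionary gaugeable.» [claim: Vukolov2026, status: under-review] [cite: Vukolov2026, Thm 9.4 p.33 l.62–75; Thm 1.2 p.8 l.43–46] -/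
def Step_94 : Prop :=
  ∀ ν : ℝ, 0 < ν → ∀ V₀ : E3 → E3, IsDatum V₀ → IsRank1Form V₀ → InA ν V₀

/-- **Step 4 — «For rank-0 fields, it is trivial» p.34 l.11** (Thm 1.2 p.8 l.46 «If rank(∇V0) = 0, then V0
is constant and trivially gaugeable»). TRUE for the literal class: `step_rank0_holds`.
[claim: Vukolov2026, status: under-review] [cite: Vukolov2026, Thm 9.6 proof p.34 l.11; Thm 1.2 p.8 l.46] -/
def Step_rank0 : Prop :=
  ∀ ν : ℝ, 0 < ν → ∀ V₀ : E3 → E3, IsDatum V₀ → IsConst V₀ → InA ν V₀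

/-- **Theorem 9.6 (All fields are gaugeable) p.34 l.7–9**: «Every smooth divergence-free vector field on
R³ (or on a bounded domain with appropriate boundary conditions) is evolutionary gaugeable» (ℝ³ face).
Consumed by §10.2 Step 1 p.35 l.23–26 («By Theorem 9.6 … Hence V0 ∈ A»). DERIVED below from Steps 1–4
(`step96_of_cases`), exactly as printed p.34 l.10–11. [claim: Vukolov2026, status: under-review]
[cite: Vukolov2026, Thm 9.6 p.34 l.7–11; §10.2 Step 1 p.35 l.23–26] -/
def Step_96 : Prop :=
  ∀ ν : ℝ, 0 < ν → ∀ V₀ : E3 → E3, IsDatum V₀ → InA ν V₀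

/-- Thm 9.6 with the axisymmetric-no-swirl reference field (the reading §10.2 Step 3 p.35 l.30–31 uses:
«The axisymmetric reference field Vax(t) is globally regular by [22, 12]»). [claim: Vukolov2026, status: under-review]
[cite: Vukolov2026, Thm 9.6 p.34 l.7–11; §10.2 Step 3 p.35 l.30–34; §2.3 p.11 l.2–9] -/
def Step_96ax : Prop :=
  ∀ ν : ℝ, 0 < ν → ∀ V₀ : E3 → E3, IsDatum V₀ → InAax ν V₀

/-- **§10.2 Step 3 p.35 l.30–31 / §2.3 p.11 l.9** «Such flows are known to be globally regular [22, 12]»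
(axisymmetric flows without swirl): the tree's THEOREM, cited by name (Ladyzhenskaya 1968 /
Ukhovskii–Yudovich 1968; Lemarié-Rieusset 2016 Thm 10.4). TRUE: `step_axisym_holds`.
[cite: Vukolov2026, §2.3 p.11 l.9; §10.2 Step 3 p.35 l.30–31] [cite: LemarieRieusset2016, Thm 10.4 p. 285] -/
def Step_axisym : Prop :=
  axisymmetric_no_swirl_global_regularity

/-! ### Second printed route: density + closure (§1.4 p.9 l.3–4; §7 Thm 7.5; §8 Thm 8.7) -/

/-- **Theorem 7.5 (Density of gaugeable fields) p.29 l.36–41** at the grain of its proof («By Lemma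
7.1, the sequence V0^(N) converges to V0 in C∞. By Theorem 7.2, each V0^(N) ∈ A»): every smooth
divergence-free field is the C^∞-limit of a SEQUENCE of smooth divergence-free members of `A`.
RECORDED inputs: Lemma 7.1 p.27–28 (angular Fourier truncation (59)–(60), TRUE-type); **Thm 7.2 p.28
l.6–8 «For each N, the truncated field V0^(N) belongs to the gaugeable class A»**, whose Step 2 p.28
l.32–37 reads «V̄0 is axisymmetric (hence gaugeable)» for the axisymmetric PROJECTION (which carries
swirl in general) and invokes a Nash–Moser openness Thm H.11 («a neighborhood of that field consisting
entirely of gaugeable fields»), Step 3 connectedness, Lemma 7.3 closedness along the homotopy.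
[claim: Vukolov2026, status: under-review] [cite: Vukolov2026, Thm 7.5 p.29 l.36–41; Thm 7.2 p.28 l.6–60; Thm 1.3 p.8 l.48–50] -/
def Step_75 : Prop :=
  ∀ ν : ℝ, 0 < ν → ∀ V₀ : E3 → E3, IsDatum V₀ →
    ∃ W : ℕ → E3 → E3, (∀ n, IsDatum (W n) ∧ InA ν (W n)) ∧ CinfConverges W V₀

/-- **Theorem 8.7 (Closure of A) p.31 l.110–125 / Thm 1.4 p.9 l.1–2** at the grain §8.1 p.29 l.58–60 sets
up («Let {V0^(n)} ⊂ A be a sequence converging to V0 in C∞»): sequential C^∞-closedness of `A`.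
RECORDED consumed displays: the datum-level gauge relation (64) p.29–30 «V0^(n) = (ψ0^(n))∗ V̄0^(n),
where V̄0^(n) = Ax(V0^(n)) is the axial part» (a THIRD reading of membership), the conformal entropy (66)
p.30, **Lemma 8.1 p.30 l.27–28 «There exists a constant C independent of n such that Cn ≤ C»**, Lemmas
8.2–8.6, Cheeger–Gromov Thm 8.4 p.31. [claim: Vukolov2026, status: under-review] [cite: Vukolov2026, Thm 8.7 p.31 l.110–125; §8.1 p.29 l.58–p.30 l.28; Thm 1.4 p.9 l.1–2] -/
def Step_87 : Prop :=
  ∀ ν : ℝ, 0 < ν → ∀ (W : ℕ → E3 → E3) (V₀ : E3 → E3), (∀ n, IsDatum (W n) ∧ InA ν (W n)) →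
    IsDatum V₀ → CinfConverges W V₀ → InA ν V₀

/-! ### Inside Step 2: the rank-2 chain at CHAIN LEVEL (RULINGS v1.45 (h2): both faces of the constant) -/

/-- **The entropy readouts of a candidate gauge evolution on `[0, Tmax)`** (the hierarchy `Hk(t)`,
`k ≥ 1`, of App. G Def G.4 p.66 / (9) p.11, and «the C^{k+2} norms of Vax(t)» on which the constants
depend — Thm 6.1 p.25 l.1–3, Thm G.6 p.67 l.7–9): typed abstractly, as real functions of time attached
to a maximal existence time `Tmax ∈ (0, ∞]` (Thm 6.5 proof p.26 l.40–41), because the functional (9)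
lives on the variable metric `g(t)` of the unprinted coupled system (RETYPE may refine; C167
`XiReadout` precedent). [cite: Vukolov2026, (9) p.11 l.37–65; Def G.4 p.66; Thm G.6 p.67 l.7–17; Thm 6.5 p.26 l.39–47] -/
structure EntropyReadout where
  /-- maximal existence time of the gauge system (Thm 6.5 proof p.26 l.40–41), `⊤` = global. -/
  Tmax : ℝ≥0∞
  Tmax_pos : 0 < Tmax
  /-- `Hk(t)`, `k ≥ 1` (Def G.4; Remark G.5 p.67 l.1–2 «H1 ≤ H2 ≤ ⋯»). -/
  H : ℕ → ℝ → ℝ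
  /-- `‖Vax(t)‖_{C^{k+2}}`, the quantity the constant `Ck` depends on (Thm G.6 p.67 l.7–9). -/
  normVax : ℕ → ℝ → ℝ
  H_nonneg : ∀ k t, 0 ≤ H k t
  H_mono : ∀ k t, H k t ≤ H (k + 1) t

/-- `t` is an existence time of the readout: `0 ≤ t < Tmax`. [cite: Vukolov2026, Thm 6.5 proof p.26 l.40–48] -/
def EntropyReadout.Alive (R : EntropyReadout) (t : ℝ) : Prop :=
  0 ≤ t ∧ ENNReal.ofReal t < R.Tmax

/-- **Thm G.6 (211) p.67 l.7–15 / Thm 6.1 (51) p.25 l.1–17, PER-INTERVAL face (print-literal)**: «For each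
k ≥ 1, there exists a constant Ck depending only on ν, the C^{k+2} norms of Vax, and the choice of Φ,
such that along the flow, d/dt Hk(t) ≤ −(ν/2) Hk+1(t) + Ck Hk(t) + Ck. (211) Moreover, the constants Ck
can be chosen independently of time on any finite interval where the solution exists.» Typed: `Ck` is a
FUNCTION of a bound `M` on the C^{k+2} norms of `Vax` over the interval (p.67 l.27–28 «The constant C1
depends on the C³ norms of Vax, but these are fixed quantities»; l.47–49 «The key point about
time-independence of Ck follows from the inductive structure: … all lower-order entropies … are bounded
on any finite time interval (by Theorem G.7 below)»). [claim: Vukolov2026, status: under-review]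
[cite: Vukolov2026, Thm G.6 (211) p.67 l.7–17, l.27–28, l.47–49; Thm 6.1 (51) p.25 l.1–17] -/
def Step_G6_interval (ν : ℝ) (R : EntropyReadout) : Prop :=
  ∀ k : ℕ, 1 ≤ k → ∃ C : ℝ → ℝ, ∀ M T : ℝ, (∀ t, R.Alive t → t ≤ T → R.normVax k t ≤ M) →
    ∀ t, R.Alive t → t ≤ T → DifferentiableAt ℝ (R.H k) t ∧
      deriv (R.H k) t ≤ -(ν / 2) * R.H (k + 1) t + C M * R.H k t + C M

/-- **Thm G.6 / Thm 6.1, TIME-UNIFORM face — the one Thm G.7 (213)–(214) p.67 l.61–70 and Thm 6.5's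
continuation p.26 l.43–47 CONSUME** («H1(t) ≤ (H1(0) + 1)e^{C1 t} − 1 ≤ C1,T for all t ≤ T», «constants
depending only on T and the initial data … remain bounded as T → T⁻max because they depend on Hk+4(0)
and T»): ONE constant `Ck`, fixed by the data at time `0`, valid at every existence time.
[claim: Vukolov2026, status: under-review] [cite: Vukolov2026, Thm G.7 (212)–(214) p.67 l.55–70; Thm 6.5 proof p.26 l.43–47; Cor 6.2 (52) p.25 l.22–28] -/
def Step_G6_uniform (ν : ℝ) (R : EntropyReadout) : Prop :=
  ∀ k : ℕ, 1 ≤ k → ∃ C : ℝ, ∀ t, R.Alive t → DifferentiableAt ℝ (R.H k) t ∧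
    deriv (R.H k) t ≤ -(ν / 2) * R.H (k + 1) t + C * R.H k t + C

/-- **Thm 6.5 proof p.26 l.43–48, the bound AS CONSUMED** («these constants remain bounded as T → T⁻max
because they depend on Hk+4(0) and T … Therefore, the norms … are uniformly bounded for t ∈ [0, Tmax)»):
if `Tmax < ∞`, every entropy `Hk` is bounded on `[0, Tmax)`. [claim: Vukolov2026, status: under-review]
[cite: Vukolov2026, Thm 6.5 proof p.26 l.43–49] -/
def Step_65_bounds (R : EntropyReadout) : Prop :=
  R.Tmax < ⊤ → ∀ k : ℕ, 1 ≤ k → ∃ B : ℝ, ∀ t, R.Alive t → R.H k t ≤ B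

/-- **Thm 6.5 p.26 l.36–59, the continuation criterion as printed** («By the Arzelà–Ascoli theorem …
using the local existence theorem with initial data (U∗, g∗) at time Tmax, we can extend the solution
beyond Tmax, contradicting the maximality»): bounded entropies on `[0, Tmax)` with `Tmax < ∞` are
impossible. [claim: Vukolov2026, status: under-review] [cite: Vukolov2026, Thm 6.5 proof p.26 l.48–59] -/
def Step_65_continuation (R : EntropyReadout) : Prop :=
  R.Tmax < ⊤ → (∀ k : ℕ, 1 ≤ k → ∃ B : ℝ, ∀ t, R.Alive t → R.H k t ≤ B) → False

/-- The rank-2 chain closes AS CONSUMED: bounds + continuation ⇒ `Tmax = ∞` (Thm 6.5's conclusion «the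
solution is global»). Pure logic. [cite: Vukolov2026, Thm 6.5 p.26 l.36–59] -/
theorem tmax_eq_top_of_chain (R : EntropyReadout) (hb : Step_65_bounds R)
    (hc : Step_65_continuation R) : R.Tmax = ⊤ := by
  by_contra h
  exact hc (lt_top_iff_ne_top.2 h) (hb (lt_top_iff_ne_top.2 h))

/-! ## Clay link -/

/-- **The one honest extra hypothesis between the LITERAL face and (A)** (keeper lit-4 g9 16:02:38Z;
CLAYVARIANTS-USAGE «PITFALL — decay-free claimed class»): for every `ν > 0` and every Clay datum SOME
global classical solution from it has energy bounded on every compact slab (EXISTENTIAL per datum — TRUE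
iff (A); never refutable by a parasitic solution). Δ6 (no (7) printed). [cite: FeffermanClay2006, (A) with (7) p. 2] [cite: Vukolov2026, Thm 1.5 p.9 l.6–12] -/
def ClayDelta : Prop :=
  ∀ ν : ℝ, 0 < ν → ∀ V₀ : E3 → E3, ContDiff ℝ ∞ V₀ → NSWave0.IsDivFree V₀ → HasRapidSpatialDecay V₀ →
    ∃ (V : ℝ → E3 → E3) (P : ℝ → E3 → ℝ), IsClassicalNSSolutionOn (Ici 0) ν 0 V P ∧ V 0 = V₀ ∧
      ∀ T : ℝ, 0 < T → ∃ A : ℝ≥0∞, A < ⊤ ∧ ∀ t ∈ Icc 0 T, (∫⁻ x, ‖V t x‖ₑ ^ 2) ≤ A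

/-! ## PROVED: kernel facts about the typed definition (ROUTE-5b records; no verdict implied) -/

/-- The identity gauge pushes forward trivially: `(id)∗W = W` (§2.1 p.10 l.11–12 with `ϕ = id`; §2.4 p.11
l.14 «ψ0 = id»). [cite: Vukolov2026, §2.1 p.10 l.11–12; §2.4 p.11 l.14] -/
theorem pushforward_trivial (t : ℝ) (W : E3 → E3) :
    pushforward (GaugeFamily.trivial.ψ t) (GaugeFamily.trivial.ψi t) W = W := by
  funext y
  simp [pushforward, GaugeFamily.trivial]

/-- **Def 2.6 unpacked (§10.2 Steps 2–5 p.35 l.27–40)**: membership in `A` CONTAINS a global classical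
Navier–Stokes solution from `V₀`. [cite: Vukolov2026, Def 2.6 p.12 l.22–27; §10.2 Steps 2–5 p.35 l.27–40] -/
theorem globalSol_of_inA {ν : ℝ} {V₀ : E3 → E3} (h : InA ν V₀) :
    ∃ (V : ℝ → E3 → E3) (P : ℝ → E3 → ℝ), IsClassicalNSSolutionOn (Ici 0) ν 0 V P ∧ V 0 = V₀ := by
  obtain ⟨G, Vax, P, -, hsol, h0⟩ := h
  exact ⟨fun t => pushforward (G.ψ t) (G.ψi t) (Vax t), P, hsol, h0⟩

/-- Conversely a global classical solution is a member of `A` with the identity gauge and `Vax := V`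
(«any reference field», §2.4 p.11 l.20; Remark 5.4 p.23 «we set Vax(0) = V0»). [cite: Vukolov2026, Def 2.6 p.12 l.22–25; §2.4 p.11 l.14–25; Remark 5.4 p.23 l.76–81] -/
theorem inA_of_globalSol {ν : ℝ} {V₀ : E3 → E3} {V : ℝ → E3 → E3} {P : ℝ → E3 → ℝ}
    (hsol : IsClassicalNSSolutionOn (Ici 0) ν 0 V P) (h0 : V 0 = V₀) : InA ν V₀ := by
  refine ⟨GaugeFamily.trivial, V, P, hsol.smooth_velocity, ?_, ?_⟩
  · have : (fun t => pushforward (GaugeFamily.trivial.ψ t) (GaugeFamily.trivial.ψi t) (V t)) = V :=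
      funext fun t => pushforward_trivial t (V t)
    rw [this]
    exact hsol
  · rw [pushforward_trivial, h0]

/-- **`V₀ ∈ A(ν)` ⇔ a global classical solution from `V₀` exists** (Def 2.6 as typed).
[cite: Vukolov2026, Def 2.6 p.12 l.22–27] -/
theorem inA_iff_globalSol {ν : ℝ} {V₀ : E3 → E3} :
    InA ν V₀ ↔ ∃ (V : ℝ → E3 → E3) (P : ℝ → E3 → ℝ), IsClassicalNSSolutionOn (Ici 0) ν 0 V P ∧ V 0 = V₀ :=
  ⟨globalSol_of_inA, fun ⟨_, _, hsol, h0⟩ => inA_of_globalSol hsol h0⟩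

/-- **ROUTE-5b RECORD: Theorem 9.6 as typed is EQUIVALENT to the claimed theorem** (RULINGS v1.45 (h1):
«Def 2.6 is self-certifying»). [cite: Vukolov2026, Thm 9.6 p.34 l.7–11; Def 2.6 p.12 l.22–27; Thm 1.5 p.9 l.6–12] -/
theorem step96_iff_claimedTheorem : Step_96 ↔ ClaimedTheorem :=
  ⟨fun h ν hν V₀ hV₀ => globalSol_of_inA (h ν hν V₀ hV₀),
    fun h ν hν V₀ hV₀ => by obtain ⟨V, P, hs, h0⟩ := h ν hν V₀ hV₀; exact inA_of_globalSol hs h0⟩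

/-- The axisymmetric-reference face is at least as strong. [cite: Vukolov2026, §2.3 p.11 l.2–9; Def 2.6 p.12] -/
theorem inA_of_inAax {ν : ℝ} {V₀ : E3 → E3} (h : InAax ν V₀) : InA ν V₀ := by
  obtain ⟨G, Vax, P, hsm, -, hsol, h0⟩ := h
  exact ⟨G, Vax, P, hsm, hsol, h0⟩

/-- [cite: Vukolov2026, Thm 9.6 p.34 l.7–11; §10.2 Step 3 p.35 l.30–34] -/
theorem step96_of_step96ax (h : Step_96ax) : Step_96 :=
  fun ν hν V₀ hV₀ => inA_of_inAax (h ν hν V₀ hV₀)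

/-- **`ψ0 = id` forces `V₀ = Vax(0)`** (Remark 5.4 p.23 l.76–77 «At t = 0, we have ψ0 = id, so (46) gives
V0 = Vax(0)»): a member of the axisymmetric-reference class is ITSELF axisymmetric without swirl.
Kernel fact about the typed definition; refuter's / referee's call what it means for the row.
[cite: Vukolov2026, Remark 5.4 p.23 l.76–81; §2.4 p.11 l.14; §2.3 p.11 l.2–8] -/
theorem isAxisymmetric_of_inAax {ν : ℝ} {V₀ : E3 → E3} (h : InAax ν V₀) :
    IsAxisymmetric V₀ ∧ HasNoSwirl V₀ := by
  obtain ⟨G, Vax, P, -, hax, -, h0⟩ := h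
  have hid : pushforward (G.ψ 0) (G.ψi 0) (Vax 0) = Vax 0 := by
    have hψ : G.ψ 0 = id := funext G.init
    have hψi : G.ψi 0 = id := by
      funext y
      have := G.right_inv 0 le_rfl y
      rw [hψ] at this
      simpa using this
    funext y
    simp [pushforward, hψ, hψi, fderiv_id]
  rw [← h0, hid]
  exact hax 0 le_rfl

/-! ## PROVED: Step 4 and the axisymmetric regularity fact -/

/-- **Step 4 HOLDS (kernel)**: a constant datum `c` has the global classical solution `V ≡ c`, `P ≡ 0`,
hence lies in `A` (identity gauge). [cite: Vukolov2026, Thm 9.6 proof p.34 l.11; Thm 1.2 p.8 l.46] -/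
theorem step_rank0_holds : Step_rank0 := by
  intro ν _hν V₀ _hV₀ ⟨c, hc⟩
  have hV₀ : V₀ = fun _ => c := funext hc
  refine inA_of_globalSol (V := fun _ _ => c) (P := fun _ _ => 0) ?_ (by rw [hV₀])
  refine ⟨?_, ?_, ?_, ?_⟩
  · exact contDiff_const.contDiffOn
  · exact contDiff_const.contDiffOn
  · intro t _ht x
    have h1 : timeDerivWithin (Ici (0:ℝ)) (fun (_ : ℝ) (_ : E3) => c) t x = 0 := by
      simp [timeDerivWithin]
    have h2 : convect (fun _ : E3 => c) (fun _ : E3 => c) x = 0 := by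
      simp [convect]
    have h3 : (Δ (fun _ : E3 => c)) x = 0 := by
      simp
    have h4 : gradient (fun _ : E3 => (0:ℝ)) x = 0 := by
      simp [gradient]
    rw [h1, h2, h3, h4]
    simp
  · intro t _ht x
    simp [VectorCalculus.divergence]

/-- `Step_rank0` — `_holds` alias of `step_rank0_holds` above under the fact's exact name (appended
2026-08-28, D-0026 bookkeeping: the proof term is the existing theorem of this file; no statement,
definition or attribute is edited; no new named fact; the ledger's debt table listed the fact
unproved). [cite: Vukolov2026, Thm 9.6 proof p.34 l.11; Thm 1.2 p.8 l.46] -/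
theorem _root_.Literature.Claims.NS.Vukolov2026.Step_rank0_holds : Step_rank0 :=
  _root_.Literature.Claims.NS.Vukolov2026.step_rank0_holds

/-- **§10.2 Step 3's cited fact HOLDS (tree theorem)**. [cite: LemarieRieusset2016, Thm 10.4 p. 285] [cite: Vukolov2026, §2.3 p.11 l.9] -/
theorem step_axisym_holds : Step_axisym :=
  axisymmetric_no_swirl_global_regularity_holds

/-- `Step_axisym` — `_holds` alias of `step_axisym_holds` above under the fact's exact name (appended
2026-08-28, D-0026 bookkeeping: the proof term is the existing theorem of this file; no statement,
definition or attribute is edited; no new named fact; the ledger's debt table listed the fact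
unproved). [cite: Vukolov2026, §2.3 p.11 l.9] -/
theorem _root_.Literature.Claims.NS.Vukolov2026.Step_axisym_holds : Step_axisym :=
  _root_.Literature.Claims.NS.Vukolov2026.step_axisym_holds

/-! ## COMPOSITION OF THE PRINTED CHAIN (PROVED, pure logic) -/

/-- **Theorem 9.6 from its printed three-case proof p.34 l.10–11** («For rank-2 fields … Theorem 6.7. For
rank-1 fields … Theorem 9.4. For rank-0 fields, it is trivial»), with Cor 2.3 (Step 1) as the
exhaustiveness of the cases. [cite: Vukolov2026, Thm 9.6 proof p.34 l.10–11; Cor 2.3 p.10 l.44–47] -/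
theorem step96_of_cases (hC23 : Step_C23) (h67 : Step_67) (h94 : Step_94) (h0 : Step_rank0) :
    Step_96 := by
  intro ν hν V₀ hV₀
  by_cases h1 : IsRank1Form V₀
  · exact h94 ν hν V₀ hV₀ h1
  by_cases hc : IsConst V₀
  · exact h0 ν hν V₀ hV₀ hc
  exact h67 ν hν V₀ hV₀ (hC23 V₀ hV₀ h1 hc)

/-- **COMPOSITION (PROVED)** — §10.2 Steps 1–5 p.35 l.23–40: Step 1 = Thm 9.6 (from Steps 1–4), Steps
2–5 = Def 2.6 unpacked. [cite: Vukolov2026, §10.2 p.35 l.23–40] -/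
theorem claim_of_steps (hC23 : Step_C23) (h67 : Step_67) (h94 : Step_94) (h0 : Step_rank0) :
    ClaimedTheorem :=
  step96_iff_claimedTheorem.1 (step96_of_cases hC23 h67 h94 h0)

/-- The same composition with binder 4 discharged in the kernel. [cite: Vukolov2026, §10.2 p.35 l.23–40] -/
theorem claim_of_steps₃ (hC23 : Step_C23) (h67 : Step_67) (h94 : Step_94) : ClaimedTheorem :=
  claim_of_steps hC23 h67 h94 step_rank0_holds

/-- **Second printed route (PROVED logic)**: dense ∧ closed ⇒ everything (§1.4 p.9 l.3–4; abstract p.1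
l.24–27). [cite: Vukolov2026, §1.4 p.9 l.3–4; Thm 7.5 p.29; Thm 8.7 p.31] -/
theorem step96_of_dense_closed (h75 : Step_75) (h87 : Step_87) : Step_96 := by
  intro ν hν V₀ hV₀
  obtain ⟨W, hW, hconv⟩ := h75 ν hν V₀ hV₀
  exact h87 ν hν W V₀ hW hV₀ hconv

/-- [cite: Vukolov2026, §1.4 p.9 l.3–5; Thm 1.5 p.9 l.6–12] -/
theorem claim_of_dense_closed (h75 : Step_75) (h87 : Step_87) : ClaimedTheorem :=
  step96_iff_claimedTheorem.1 (step96_of_dense_closed h75 h87)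

/-! ## CLAY LINK (PROVED) -/

/-- **The Clay reading IS (A)**, token for token. [cite: FeffermanClay2006, (A) p. 2] [cite: Vukolov2026, Thm 1.5 p.9 l.6–12] -/
theorem claimedTheoremA_iff_clayA : ClaimedTheoremA ↔ clayR3.Regularity :=
  Iff.rfl

/-- **`ClayDelta ⇒ (A)`** through the tree door `clayR3_solvable_of_classical_slabBoundedEnergy` (the
datum's energy is finite by (4): `HasRapidSpatialDecay.lintegral_enorm_sq_lt_top`).
[cite: FeffermanClay2006, (A) with (4) (6) (7) p. 2] -/
theorem clayA_of_delta (hΔ : ClayDelta) : clayR3.Regularity := by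
  intro ν hν V₀ hsm hdiv hdec
  obtain ⟨V, P, hcl, h0, hE⟩ := hΔ ν hν V₀ hsm hdiv hdec
  exact clayR3_solvable_of_classical_slabBoundedEnergy hν hdec.lintegral_enorm_sq_lt_top hcl h0 hE

/-- TYPING-HYGIENE 10 (b): `ClayDelta → ClaimedTheorem → (A)` (the literal face contributes nothing the
delta does not already carry — recorded honestly: the delta IS the Clay content on (4)-data).
[cite: FeffermanClay2006, (A) p. 2] [cite: Vukolov2026, Thm 1.5 p.9 l.6–12] -/
theorem clay_of_claimed_of_delta (hΔ : ClayDelta) (_h : ClaimedTheorem) : clayR3.Regularity :=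
  clayA_of_delta hΔ

/-- With the Clay reading, the printed chain would settle (A). [cite: Vukolov2026, §10.3.3 p.37; Thm 1.5 p.9] -/
theorem clayA_of_claimedA (h : ClaimedTheoremA) : clayR3.Regularity :=
  claimedTheoremA_iff_clayA.1 h

end

end Literature.Claims.NS.Vukolov2026
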